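import Summits.RiemannHypothesis.RiemannHypothesis.Theorems.JensenPolynomialsSkeletonSecondOrder

/-!
# Route `JensenPolynomials` — rung J-P (P1⁺): the PERTURBATION EXPANSION `P = F(D)·P⁰` and the kernel BLUEPRINT of the
# skeleton sign test (the CAL inequality `Σ_{m=3}^{d} E_m K_m < 1` as a schema)

**RH-FREE, ξ-free** (an arbitrary real sequence `γ`; the ξ-instance only adds `κ_n > 0`, tree `skelKappa_xi_pos`).

* **Appell derivative property** (`iterate_derivative_appellPoly`): `D^m A^d_r = d(d−1)⋯(d−m+1)·A^{d−m}_r`.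
* **Binomial-convolution theorem** (`appellPoly_binomConv`): if `r = f ⋆ s` binomially
  (`r_j = Σ_i C(j,i) f_{j−i} s_i`, i.e. `g_r = F·g_s` for the EGFs, `F(w) = Σ f_m w^m/m!`), then
  `A^d_r = Σ_{m ≤ d} C(d,m) f_m · A^{d−m}_s = Σ_m (f_m/m!) D^m A^d_s = F(D) A^d_s` — the CAL's multiplicative frame
  `P = F(D) P⁰` (ALPHA-DISC §0, ALPHA-WRITEUP §1.4) as a kernel identity. With the second-order matching
  (`JensenPolynomialsSkeletonSecondOrder`: `r₀ = s₀ = 1`, `r₁ = s₁`, `r₂ = s₂`) the quotient coefficients satisfy `f₀ = 1`,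
  `f₁ = f₂ = 0` (`binomConv_coeff_zero/one/two`), so at a critical point `e` of `P⁰`:
  `P(e) = P⁰(e) + Σ_{m=3}^{d} C(d,m) f_m A^{d−m}_s(e)` — the expansion starts at order `3`.
* **BLUEPRINT** (`skeletonSignTest_of_majorant`, `skeletonSignTest_of_tables`): for `γ(n), γ(n+1) ≠ 0`, `κ_n > 0`, `d ≥ 2`
  and ANY `f` with `r_n = f ⋆ s_n` up to index `d`: if at every critical point `e` of the skeleton
  `Σ_{m=3}^{d} |C(d,m) f_m|·|A^{d−m}_{s_n}(e)| < |A^{d}_{s_n}(e)|` — in particular if there are tables `E_m ≥ |C(d,m) f_m|`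
  and `K_m` with `|A^{d−m}_{s_n}(e)| ≤ K_m·|A^{d}_{s_n}(e)|` at every critical point and `Σ_{m=3}^{d} E_m K_m < 1` — then
  `SkeletonSignTest γ d n`. This is exactly the shape of THEOREM α's CAL certificate (`E_m` from TABLE Z / LEMMA Z′ on the
  cumulant differences, `K_m` from LEMMA R/L1 = tree `laguerre_interlacingRatio_abs_le`, `F(d,n) = Σ E_m K_m < 1`), now a
  kernel schema: a kernel proof of `TheoremAlphaCertFlat` = these two tables as tree theorems for `3 ≤ d ≤ 41`, `n ≥ 10⁴`.

WHAT THIS IS NOT: no table is supplied here and no cell of the test is proved; nothing here bears on the truth of RH.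
-/

noncomputable section
-- D-0017: `Summit.RiemannHypothesis.RiemannHypothesis.…` duplicates the namespace BY DESIGN (single-problem summit).
set_option linter.dupNamespace false

namespace Summit.RiemannHypothesis.RiemannHypothesis.Theorems.JensenPolynomials

open Literature.NumberTheory.LFunctions Polynomial Finset
open scoped BigOperators Nat

/-! ## Appell derivative property -/

/-- `A^d_r` depends only on `r(0), …, r(d)`. -/
theorem appellPoly_congr {r r' : ℕ → ℝ} {d : ℕ} (h : ∀ j ≤ d, r j = r' j) : appellPoly r d = appellPoly r' d := by
  unfold appellPoly
  refine Finset.sum_congr rfl fun j hj => ?_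
  rw [h j (Nat.lt_succ_iff.mp (mem_range.mp hj))]

/-- **Appell property**: `D^m A^d_r = d^{(m)}·A^{d−m}_r` with the falling factorial `d^{(m)} = d(d−1)⋯(d−m+1)`, `m ≤ d`. -/
theorem iterate_derivative_appellPoly (r : ℕ → ℝ) {d m : ℕ} (hm : m ≤ d) :
    derivative^[m] (appellPoly r d) = C ((d.descFactorial m : ℕ) : ℝ) * appellPoly r (d - m) := by
  ext k
  rw [coeff_iterate_derivative, coeff_C_mul, coeff_appellPoly, coeff_appellPoly, nsmul_eq_mul]
  by_cases hk : k + m ≤ d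
  · rw [if_pos hk, if_pos (by omega), show d - m - k = d - (k + m) by omega]
    set j := d - (k + m) with hj
    have hd : k + m = d - j := by omega
    have hmj : m + j ≤ d := by omega
    -- the multinomial identity `(k+m)^{(m)}·C(d, j) = d^{(m)}·C(d−m, j)` (`d = j + k + m`)
    have h1 : (d.choose m : ℝ) * ((d - m).choose j : ℝ) = (d.choose (m + j) : ℝ) * ((m + j).choose m : ℝ) := by
      rw [← Nat.cast_mul, ← Nat.cast_mul, Nat.choose_mul (Nat.le_add_right m j), Nat.add_sub_cancel_left]
    have h2 : (d.choose j : ℝ) * ((k + m).choose m : ℝ) = (d.choose (m + j) : ℝ) * ((m + j).choose m : ℝ) := by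
      have h := Nat.choose_mul (n := d) (Nat.le_add_left j m)
      rw [Nat.add_sub_cancel, show d - j = k + m by omega] at h
      rw [← Nat.cast_mul, ← Nat.cast_mul, ← h, Nat.choose_symm_add]
    have key : ((k + m).descFactorial m : ℝ) * (d.choose j : ℝ) =
        (d.descFactorial m : ℝ) * ((d - m).choose j : ℝ) := by
      rw [Nat.descFactorial_eq_factorial_mul_choose, Nat.descFactorial_eq_factorial_mul_choose]
      push_cast
      calc (m ! : ℝ) * ((k + m).choose m : ℝ) * (d.choose j : ℝ)
          = (m ! : ℝ) * ((d.choose j : ℝ) * ((k + m).choose m : ℝ)) := by ring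
        _ = (m ! : ℝ) * ((d.choose m : ℝ) * ((d - m).choose j : ℝ)) := by rw [h2, h1]
        _ = (m ! : ℝ) * (d.choose m : ℝ) * ((d - m).choose j : ℝ) := by ring
    calc ((k + m).descFactorial m : ℝ) * ((d.choose j : ℝ) * r j)
        = (((k + m).descFactorial m : ℝ) * (d.choose j : ℝ)) * r j := by ring
      _ = ((d.descFactorial m : ℝ) * ((d - m).choose j : ℝ)) * r j := by rw [key]
      _ = (d.descFactorial m : ℝ) * (((d - m).choose j : ℝ) * r j) := by ring
  · rw [if_neg hk, if_neg (by omega), mul_zero, mul_zero]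

/-- The critical points of `A^d_r` are the zeros of `A^{d−1}_r` (`d ≥ 1`). -/
theorem derivative_appellPoly_eval_eq_zero_iff (r : ℕ → ℝ) {d : ℕ} (hd : 1 ≤ d) (e : ℝ) :
    (derivative (appellPoly r d)).eval e = 0 ↔ (appellPoly r (d - 1)).eval e = 0 := by
  have h := iterate_derivative_appellPoly r hd
  rw [Function.iterate_one] at h
  rw [h, eval_mul, eval_C, mul_eq_zero, Nat.descFactorial_one]
  have : ((d : ℕ) : ℝ) ≠ 0 := by exact_mod_cast (by omega : d ≠ 0)
  simp [this]

/-! ## The binomial-convolution theorem (`P = F(D) P⁰`) -/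

/-- **Binomial-convolution theorem (real form)**: for all `f, s : ℕ → ℝ`, `y : ℝ`, `d : ℕ`,
`Σ_{j≤d} C(d,j)·(Σ_{i≤j} C(j,i) f_{j−i} s_i)·y^{d−j} = Σ_{m≤d} C(d,m) f_m · Σ_{i≤d−m} C(d−m,i) s_i y^{d−m−i}`. -/
theorem sum_choose_binomConv_eq (f s : ℕ → ℝ) (y : ℝ) (d : ℕ) :
    ∑ j ∈ range (d + 1), (d.choose j : ℝ) * (∑ i ∈ range (j + 1), (j.choose i : ℝ) * f (j - i) * s i) * y ^ (d - j)
      = ∑ m ∈ range (d + 1), (d.choose m : ℝ) * f m *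
          ∑ i ∈ range (d - m + 1), ((d - m).choose i : ℝ) * s i * y ^ (d - m - i) := by
  -- both sides as double sums over `i ≤ d`, `m ≤ d − i`
  have hL : ∑ j ∈ range (d + 1), (d.choose j : ℝ) * (∑ i ∈ range (j + 1), (j.choose i : ℝ) * f (j - i) * s i) *
        y ^ (d - j) = ∑ j ∈ range (d + 1), ∑ i ∈ range (j + 1),
          (d.choose j : ℝ) * (j.choose i : ℝ) * f (j - i) * s i * y ^ (d - j) := by
    refine Finset.sum_congr rfl fun j _ => ?_
    rw [Finset.mul_sum, Finset.sum_mul]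
    refine Finset.sum_congr rfl fun i _ => ?_
    ring
  have hR : ∑ m ∈ range (d + 1), (d.choose m : ℝ) * f m *
        ∑ i ∈ range (d - m + 1), ((d - m).choose i : ℝ) * s i * y ^ (d - m - i)
      = ∑ m ∈ range (d + 1), ∑ i ∈ range (d - m + 1),
          (d.choose m : ℝ) * f m * (((d - m).choose i : ℝ) * s i * y ^ (d - m - i)) := by
    refine Finset.sum_congr rfl fun m _ => ?_
    rw [Finset.mul_sum]
  rw [hL, hR, Finset.sum_comm' (t' := range (d + 1)) (s' := fun i => Ico i (d + 1))
    (h := fun j i => by simp only [mem_range, mem_Ico]; omega),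
    Finset.sum_comm' (s := range (d + 1)) (t := fun m => range (d - m + 1)) (t' := range (d + 1))
      (s' := fun i => range (d - i + 1)) (h := fun m i => by simp only [mem_range]; omega)]
  refine Finset.sum_congr rfl fun i hi => ?_
  have hid : i ≤ d := Nat.lt_succ_iff.mp (mem_range.mp hi)
  rw [Finset.sum_Ico_eq_sum_range, show d + 1 - i = d - i + 1 by omega]
  refine Finset.sum_congr rfl fun m hm => ?_
  have hmd : m ≤ d - i := Nat.lt_succ_iff.mp (mem_range.mp hm)
  have e3 : i + m - i = m := by omega
  have e4 : d - (i + m) = d - m - i := by omega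
  rw [e3, e4]
  have hc : (d.choose (i + m) : ℝ) * ((i + m).choose i : ℝ) = (d.choose m : ℝ) * ((d - m).choose i : ℝ) := by
    have h := Nat.choose_mul (n := d) (Nat.le_add_right m i)
    rw [Nat.add_sub_cancel_left] at h
    rw [← Nat.cast_mul, ← Nat.cast_mul, ← h, add_comm i m, ← Nat.choose_symm_add]
  calc (d.choose (i + m) : ℝ) * ((i + m).choose i : ℝ) * f m * s i * y ^ (d - m - i)
      = ((d.choose (i + m) : ℝ) * ((i + m).choose i : ℝ)) * (f m * s i * y ^ (d - m - i)) := by ring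
    _ = ((d.choose m : ℝ) * ((d - m).choose i : ℝ)) * (f m * s i * y ^ (d - m - i)) := by rw [hc]
    _ = (d.choose m : ℝ) * f m * (((d - m).choose i : ℝ) * s i * y ^ (d - m - i)) := by ring

/-- **Binomial-convolution theorem (polynomial form)**: `A^d_{f⋆s} = Σ_{m ≤ d} C(d,m) f_m · A^{d−m}_s`. -/
theorem appellPoly_binomConv (f s : ℕ → ℝ) (d : ℕ) :
    appellPoly (fun j => ∑ i ∈ range (j + 1), (j.choose i : ℝ) * f (j - i) * s i) d =
      ∑ m ∈ range (d + 1), C ((d.choose m : ℝ) * f m) * appellPoly s (d - m) := by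
  apply Polynomial.funext
  intro y
  rw [appellPoly, eval_finsetSum, eval_finsetSum]
  simp only [eval_mul, eval_C, eval_pow, eval_X, appellPoly, eval_finsetSum]
  exact sum_choose_binomConv_eq f s y d

/-- **`P = F(D) P⁰`**: the same identity with iterated derivatives, `A^d_{f⋆s} = Σ_{m ≤ d} (f_m/m!)·D^m A^d_s`. -/
theorem appellPoly_binomConv_eq_sum_iterate_derivative (f s : ℕ → ℝ) (d : ℕ) :
    appellPoly (fun j => ∑ i ∈ range (j + 1), (j.choose i : ℝ) * f (j - i) * s i) d =
      ∑ m ∈ range (d + 1), C (f m / (m ! : ℝ)) * derivative^[m] (appellPoly s d) := by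
  rw [appellPoly_binomConv]
  refine Finset.sum_congr rfl fun m hm => ?_
  have hmd : m ≤ d := Nat.lt_succ_iff.mp (mem_range.mp hm)
  rw [iterate_derivative_appellPoly s hmd, ← mul_assoc, ← C_mul, Nat.descFactorial_eq_factorial_mul_choose]
  congr 2
  have : (m ! : ℝ) ≠ 0 := by positivity
  push_cast
  field_simp

/-! ## The quotient coefficients start at order 3 -/

section quotient

variable {r s f : ℕ → ℝ}

/-- If `r = f ⋆ s` at index `0` and `r₀ = s₀ = 1` then `f₀ = 1`. -/
theorem binomConv_coeff_zero (h0 : r 0 = ∑ i ∈ range (0 + 1), ((0 : ℕ).choose i : ℝ) * f (0 - i) * s i)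
    (hr0 : r 0 = 1) (hs0 : s 0 = 1) : f 0 = 1 := by
  simp [hs0] at h0
  rw [← h0, hr0]

/-- If moreover `r = f ⋆ s` at index `1` and `r₁ = s₁` then `f₁ = 0`. -/
theorem binomConv_coeff_one (h1 : r 1 = ∑ i ∈ range (1 + 1), ((1 : ℕ).choose i : ℝ) * f (1 - i) * s i)
    (hf0 : f 0 = 1) (hs0 : s 0 = 1) (hrs1 : r 1 = s 1) : f 1 = 0 := by
  simp [Finset.sum_range_succ, hs0, hf0] at h1
  linarith

/-- If moreover `r = f ⋆ s` at index `2` and `r₂ = s₂` then `f₂ = 0`. -/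
theorem binomConv_coeff_two (h2 : r 2 = ∑ i ∈ range (2 + 1), ((2 : ℕ).choose i : ℝ) * f (2 - i) * s i)
    (hf0 : f 0 = 1) (hf1 : f 1 = 0) (hs0 : s 0 = 1) (hrs2 : r 2 = s 2) : f 2 = 0 := by
  simp [Finset.sum_range_succ, hs0, hf0, hf1] at h2
  linarith

end quotient

/-! ## The BLUEPRINT: the CAL inequality as a kernel schema -/

/-- At a critical point of a polynomial with simple zeros the value is nonzero. -/
theorem eval_ne_zero_of_derivative_eval_eq_zero {Q : ℝ[X]} (hQ : Q ≠ 0) (hnd : Q.roots.Nodup) {e : ℝ}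
    (he : (derivative Q).eval e = 0) : Q.eval e ≠ 0 := by
  classical
  intro h0
  have h1 : 1 < Q.rootMultiplicity e := (one_lt_rootMultiplicity_iff_isRoot hQ).mpr ⟨h0, he⟩
  have h2 : Q.roots.count e ≤ 1 := Multiset.nodup_iff_count_le_one.mp hnd e
  rw [count_roots] at h2
  omega

/-- **Expansion at a critical point**: for `r = f ⋆ s` up to index `d` (`d ≥ 2`) with `r₀ = s₀ = 1`, `r₁ = s₁`, `r₂ = s₂`,
`A^d_r(e) = A^d_s(e) + Σ_{m=3}^{d} C(d,m) f_m A^{d−m}_s(e)` at EVERY point `e`. -/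
theorem eval_appellPoly_binomConv_eq {r s f : ℕ → ℝ} {d : ℕ} (hd : 2 ≤ d)
    (hf : ∀ j ≤ d, r j = ∑ i ∈ range (j + 1), (j.choose i : ℝ) * f (j - i) * s i)
    (hr0 : r 0 = 1) (hs0 : s 0 = 1) (hrs1 : r 1 = s 1) (hrs2 : r 2 = s 2) (e : ℝ) :
    (appellPoly r d).eval e = (appellPoly s d).eval e +
      ∑ m ∈ Ico 3 (d + 1), (d.choose m : ℝ) * f m * (appellPoly s (d - m)).eval e := by
  have hf0 : f 0 = 1 := binomConv_coeff_zero (hf 0 (by omega)) hr0 hs0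
  have hf1 : f 1 = 0 := binomConv_coeff_one (hf 1 (by omega)) hf0 hs0 hrs1
  have hf2 : f 2 = 0 := binomConv_coeff_two (hf 2 hd) hf0 hf1 hs0 hrs2
  rw [appellPoly_congr hf, appellPoly_binomConv, eval_finsetSum, Finset.range_eq_Ico,
    ← Finset.sum_Ico_consecutive _ (by omega : 0 ≤ 3) (by omega : 3 ≤ d + 1)]
  simp only [eval_mul, eval_C]
  congr 1
  rw [show Ico 0 3 = {0, 1, 2} by decide, Finset.sum_insert (by decide), Finset.sum_insert (by decide),
    Finset.sum_singleton, hf0, hf1, hf2, Nat.choose_zero_right, Nat.sub_zero]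
  simp

/-- **BLUEPRINT of the skeleton sign test (RH-FREE, ξ-free).** Let `γ(n), γ(n+1) ≠ 0`, `κ_n > 0`, `d ≥ 2`, and let `f` be ANY
sequence with `r_n = f ⋆ s_n` binomially up to index `d` (e.g. the Taylor coefficients·`m!` of `F = g_r/g_s`; then `f₀ = 1`,
`f₁ = f₂ = 0` automatically). If at every critical point `e` of the skeleton `A^d_{s_n}` the tail is dominated,
`Σ_{m=3}^{d} |C(d,m) f_m · A^{d−m}_{s_n}(e)| < |A^d_{s_n}(e)|`, then `SkeletonSignTest γ d n`. -/
theorem skeletonSignTest_of_majorant (γ : ℕ → ℝ) (d n : ℕ) (hd : 2 ≤ d) (hn : γ n ≠ 0) (hn1 : γ (n + 1) ≠ 0)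
    (hκ : 0 < skelKappa γ n) (f : ℕ → ℝ)
    (hf : ∀ j ≤ d, windowSeq γ n j = ∑ i ∈ range (j + 1), (j.choose i : ℝ) * f (j - i) * skeletonSeq γ n i)
    (hmaj : ∀ e : ℝ, (derivative (appellPoly (skeletonSeq γ n) d)).eval e = 0 →
      ∑ m ∈ Ico 3 (d + 1), |(d.choose m : ℝ) * f m * (appellPoly (skeletonSeq γ n) (d - m)).eval e|
        < |(appellPoly (skeletonSeq γ n) d).eval e|) :
    SkeletonSignTest γ d n := by
  have hκsq : 0 ≤ skelKappaSq γ n := by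
    by_contra hneg
    rw [skelKappa, Real.sqrt_eq_zero'.mpr (not_le.mp hneg).le] at hκ
    exact lt_irrefl _ hκ
  have hr0 : windowSeq γ n 0 = 1 := windowSeq_zero γ n hn
  have hs0 : skeletonSeq γ n 0 = 1 := skeletonSeq_zero γ n
  have hrs1 : windowSeq γ n 1 = skeletonSeq γ n 1 := by rw [windowSeq_one γ n hn hn1, skeletonSeq_one]
  have hrs2 : windowSeq γ n 2 = skeletonSeq γ n 2 := (skeletonSeq_two γ n hκsq).symm
  obtain ⟨hQs, hQnd, hQdeg⟩ := splits_nodup_appellPoly_skeletonSeq γ n d hκ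
  refine
    { natDegree_eq := by rw [natDegree_appellPoly _ d (by rw [hr0]; exact one_ne_zero), hQdeg]
      two_le := by rw [hQdeg]; exact hd
      leadingCoeff_pos := by
        rw [leadingCoeff_appellPoly _ d (by rw [hr0]; exact one_ne_zero),
          leadingCoeff_appellPoly _ d (by rw [hs0]; exact one_ne_zero), hr0, hs0, mul_one]
        exact one_pos
      splits := hQs
      nodup := hQnd
      sameSign := fun e he => ?_ }
  have hexp := eval_appellPoly_binomConv_eq hd hf hr0 hs0 hrs1 hrs2 e
  set q := (appellPoly (skeletonSeq γ n) d).eval e with hq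
  set T := ∑ m ∈ Ico 3 (d + 1), (d.choose m : ℝ) * f m * (appellPoly (skeletonSeq γ n) (d - m)).eval e with hT
  have hTle : |T| < |q| := (Finset.abs_sum_le_sum_abs _ _).trans_lt (hmaj e he)
  have hq0 : q ≠ 0 := by
    intro h0
    rw [h0, abs_zero] at hTle
    exact not_lt.mpr (abs_nonneg T) hTle
  rw [hexp]
  -- `(q + T)·q = q² + T·q ≥ q² − |T|·|q| > 0`
  have h1 : |T * q| < q * q := by
    rw [abs_mul, ← abs_mul_abs_self q]
    exact mul_lt_mul_of_pos_right hTle (abs_pos.mpr hq0)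
  nlinarith [neg_abs_le (T * q)]

/-- **BLUEPRINT with tables (RH-FREE, ξ-free) — the CAL inequality `F(d,n) = Σ_{m=3}^{d} E_m K_m < 1` as a kernel schema.**
With `f` as above, a coefficient table `E_m ≥ |C(d,m) f_m|` and a ratio table `K_m` with `|A^{d−m}_{s_n}(e)| ≤ K_m·|A^d_{s_n}(e)|`
at every critical point `e` of the skeleton (`3 ≤ m ≤ d`; LEMMA R/L1 = tree `laguerre_interlacingRatio_abs_le` is of this shape),
`Σ_{m=3}^{d} E_m K_m < 1` implies `SkeletonSignTest γ d n`. -/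
theorem skeletonSignTest_of_tables (γ : ℕ → ℝ) (d n : ℕ) (hd : 2 ≤ d) (hn : γ n ≠ 0) (hn1 : γ (n + 1) ≠ 0)
    (hκ : 0 < skelKappa γ n) (f : ℕ → ℝ)
    (hf : ∀ j ≤ d, windowSeq γ n j = ∑ i ∈ range (j + 1), (j.choose i : ℝ) * f (j - i) * skeletonSeq γ n i)
    (E K : ℕ → ℝ) (hE : ∀ m ∈ Ico 3 (d + 1), |(d.choose m : ℝ) * f m| ≤ E m)
    (hK : ∀ m ∈ Ico 3 (d + 1), ∀ e : ℝ, (derivative (appellPoly (skeletonSeq γ n) d)).eval e = 0 →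
      |(appellPoly (skeletonSeq γ n) (d - m)).eval e| ≤ K m * |(appellPoly (skeletonSeq γ n) d).eval e|)
    (hsum : ∑ m ∈ Ico 3 (d + 1), E m * K m < 1) :
    SkeletonSignTest γ d n := by
  obtain ⟨-, hQnd, -⟩ := splits_nodup_appellPoly_skeletonSeq γ n d hκ
  have hQne : appellPoly (skeletonSeq γ n) d ≠ 0 :=
    appellPoly_ne_zero _ d (by rw [skeletonSeq_zero]; exact one_ne_zero)
  refine skeletonSignTest_of_majorant γ d n hd hn hn1 hκ f hf fun e he => ?_
  set q := (appellPoly (skeletonSeq γ n) d).eval e with hq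
  have hq0 : 0 < |q| := abs_pos.mpr (eval_ne_zero_of_derivative_eval_eq_zero hQne hQnd he)
  calc ∑ m ∈ Ico 3 (d + 1), |(d.choose m : ℝ) * f m * (appellPoly (skeletonSeq γ n) (d - m)).eval e|
      ≤ ∑ m ∈ Ico 3 (d + 1), E m * K m * |q| := by
        refine Finset.sum_le_sum fun m hm => ?_
        rw [abs_mul, mul_assoc]
        exact mul_le_mul (hE m hm) (hK m hm e he) (abs_nonneg _) ((abs_nonneg _).trans (hE m hm))
    _ = (∑ m ∈ Ico 3 (d + 1), E m * K m) * |q| := by rw [Finset.sum_mul]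
    _ < 1 * |q| := mul_lt_mul_of_pos_right hsum hq0
    _ = |q| := one_mul _

/-- **BLUEPRINT for `ξ`**: the same schema for `γ = xiTaylorCoeff` needs no non-degeneracy hypotheses (`γ > 0`, `κ_n > 0` are
tree theorems): two tables with `Σ_{m=3}^{d} E_m K_m < 1` at a cell `(d, n)`, `d ≥ 2`, give `SkeletonSignTest ξ d n` (hence, by
`skeletonSignTest_xi_splits`, hyperbolicity of `J^{d,n}_ξ`). RH-FREE; no table is supplied here. -/
theorem skeletonSignTest_xi_of_tables (d n : ℕ) (hd : 2 ≤ d) (f : ℕ → ℝ)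
    (hf : ∀ j ≤ d, windowSeq xiTaylorCoeff n j =
      ∑ i ∈ range (j + 1), (j.choose i : ℝ) * f (j - i) * skeletonSeq xiTaylorCoeff n i)
    (E K : ℕ → ℝ) (hE : ∀ m ∈ Ico 3 (d + 1), |(d.choose m : ℝ) * f m| ≤ E m)
    (hK : ∀ m ∈ Ico 3 (d + 1), ∀ e : ℝ, (derivative (appellPoly (skeletonSeq xiTaylorCoeff n) d)).eval e = 0 →
      |(appellPoly (skeletonSeq xiTaylorCoeff n) (d - m)).eval e| ≤
        K m * |(appellPoly (skeletonSeq xiTaylorCoeff n) d).eval e|)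
    (hsum : ∑ m ∈ Ico 3 (d + 1), E m * K m < 1) :
    SkeletonSignTest xiTaylorCoeff d n :=
  skeletonSignTest_of_tables xiTaylorCoeff d n hd (xiTaylorCoeff_pos_holds n).ne' (xiTaylorCoeff_pos_holds (n + 1)).ne'
    (skelKappa_xi_pos n) f hf E K hE hK hsum

end Summit.RiemannHypothesis.RiemannHypothesis.Theorems.JensenPolynomials

end
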